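import Summits.QuantumFields.BalabanUV.Beta.GAN24.WardResidualRotatedVertexPeriodic

/-!
# `BalabanUV.Beta.GAN24.WardResidualRotatedVertexWeighted` — binder row G-an2-4 ∕ (CONV-C), CT-W route «WC-TL» → «QR-LL», located identity of record (S) (the OWNER
# gan24-p1 g26's R12): **THE (α) PIECE READ THROUGH ANY BOUNDED BLOCK-PERIODIC TWO-LEG WEIGHT — VALUE PER SLOT, (M0) = 0, SLOT-DIPOLE CLOSED AND LABEL-FREE, ALL
# HYPOTHESES DISCHARGED** (the instance of `WardResidualRotatedVertexPeriodic` for the currency the next S-step reads: p2 g35's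
# `SandwichReadoutSiteDep.hasSum_sandwich_readout_coDressKBmAt` says the transported letter's coarse charge is the EXIT-FACE-weighted field–field pair sum of the sandwiched kernel —
# a bounded, block-periodic two-leg weight; road-P2 chair `b2b-balaban-gan24-p2`, gen 38, INTENT 5)

NOT IN PRINT; OUR BOOKKEEPING ([folklore] one weighted Fubini = leaf-06's `KernelLegCharges.summable_weight_mul_kernel` + `Summable.prod ∕ tsum_comm` with a bounded weight; the rest BY
NAME from INTENT 1–4; 0 `def`, 0 cited fact, 0 `def … : Prop`, 0 sorry).  HONEST FRAMING (cell contract, verbatim): «discharging `BetaPertH` makes Bałaban's UV stability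
UNCONDITIONAL — a real constructive-QFT result; it is NOT the continuum limit and NOT the Clay problem.»  HONEST DEPENDENCY (verbatim): «continuum YM on T⁴ ⇐ BetaPertH ∧ nine
spine estimates (0/9 proved); BetaPertH ⇐ (D1) ∧ (D4) ∧ CAP+tail; G-an2-4 gates asym, D1 and NE2/3/4.»

WHAT (a two-leg weight `ω : Site × Site → ℝ` with `|ω| ≤ B`; for §4–§5 also `Lc`-PERIODIC: `ω (x + Lc•s, z + Lc•s) = ω (x, z)`; the ω-charge of a kernel `X` is `Σ'_{(x,z)} ω(x,z)·X x z a b`).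
* §1 `hasSum_prod_wsum_weighted` — leaf-06's Fubini with a bounded two-leg weight: `HasSum ((x,z) ↦ ω(x,z)·Σ'_y w y·Q y x z a b) (Σ'_y w y·Σ'_{(x,z)} ω·Q y)` and the
  summability of `y ↦ w y·(ω-charge of Q y)`.
* §2 `hasSum_weighted_vertexOfK ∕ _vertexOfM ∕ _dM`: the ω-charge of a `dM`-read = the superposition of the ω-charges of its tables (value forms + the slot summabilities).
* §3 **`hasSum_weighted_rotatedVertex_comb`**: the ω-charge of (α) at slot `(ν,y′)` IS `V_Z(y′)` of `WardResidualRotatedVertexPeriodic` with `Z_S(κ,u) = ω-charge of S_{j+1} κ u`,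
  `Z_M(ρ′,w) = ω-charge of M1_{j+1} ρ′ w`.
* §4 for `Lc`-periodic `ω`: `tsum_weighted_shiftK_of_periodic`, `weightedCharge_SpureRecAt_block` (`Z_S` block-periodic), `weightedCharge_M1At_const` (`Z_M` slot-constant),
  `summable_colH_mul_weightedCharge` — the three hypotheses of `WardResidualRotatedVertexPeriodic` DISCHARGED for every such `ω`.
* §5 **`hasSum_totalCharge_weighted_comb`** ((M0) = 0) and **`hasSum_slotMoment_weighted_comb`** (the slot-dipole `= −¼·[Σ_κ Σ_{v∈box} (Σ'_t t_λ·colH G_{j+1} ν t κ v)·Z_S(κ,v) +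
  Σ_ρ′ (Σ'_t t_λ·colM G_{j+1} ν t ρ′ 0)·Z_M(ρ′,0)]`, label-free) for the ω-charges of (α) — the (α) side of R12's (S) ∕ (M0_y) in ANY bounded block-periodic two-leg currency,
  in particular the transported letter's (face weights `[x_a % Lc = Lc−1]·Lc·cL α a`, `[z_b % Lc = Lc−1]·Lc·cR b β` per fibre pair, summed over `(a,b)` by `HasSum.add`).
* §6 `hasSum_weightedCharge_add ∕ _smul`, `hasSum_slotMoment_add` — additivity∕homogeneity IN THE PIECE at `HasSum` level (the OWNER g27's W4 ask: (α), (γ), (β), (τ) plug into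
  ONE sum without re-proving Fubini).
Asserts NO value of Bałaban's tables; discharges NOTHING of (S) ∕ (Q-R) ∕ (LT) ∕ (Q-L) ∕ (C) ∕ «T2Shape» ∕ «T2Drift» ∕ (hW, hWall); NEVER «G-an2-4 closed» as (CONV-C); NOT D1,
NOT BetaPertH, NOT continuum, NOT Clay.  2026-08-22; no existing file touched.
-/

noncomputable section

open Finset
open scoped BigOperators
open Literature.MathematicalPhysics.QuantumFieldTheory
open Literature.MathematicalPhysics.QuantumFieldTheory.Balaban1983to89
open Literature.MathematicalPhysics.QuantumFieldTheory.Balaban1983to89.Beta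
open B12Sec2to5 (l1)
open ExpKernelCalculus (Site MKer BiLoc Decays VertexFamily shiftK)
open AffineAveraging (box toSite)
open AveragingContours (blk)
open OneStepResolventKernel (Fib LocStencil wsum)
open OneStepKernelFamily (KInvStep colH vertexOfK abs_colH_le)
open SecondOrderResponse (colM vertexOfM dM dM_apply abs_colM_le)
open InterLevelTransport (cwsum cwsum_apply)
open Summit.QuantumFields.BalabanUV.Beta.BorderedHessian (diagK)
open Summit.QuantumFields.BalabanUV.Beta.ChartConjugation (conjV)
open Summit.QuantumFields.BalabanUV.Beta.AveragingWardRootedStencils (legInd)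
open Summit.QuantumFields.BalabanUV.Beta.AxialDressingRooted (coDressKBmAt decays_coDressKBmAt_KInvStep)
open Summit.QuantumFields.BalabanUV.Beta.SpineRooted (SpureRecAt M1At locStencil_SpureRecAt vertexFamily_M1At SpureRecAt_translate M1At_translate)
open Summit.QuantumFields.BalabanUV.Beta.WardLocusResidualClass (abs_blockGen_le)
open Summit.QuantumFields.BalabanUV.Beta.GAN24.KernelLegCharges (summable_weight_mul_kernel)
open Summit.QuantumFields.BalabanUV.Beta.GAN24.WardResidualLabelSums (decays_conjV_diagK)
open Summit.QuantumFields.BalabanUV.Beta.GAN24.WardResidualRotatedVertex (colH_conjV_diagK colM_conjV_diagK blockGen_inl blockGen_zsmul_inr)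
open Summit.QuantumFields.BalabanUV.Beta.GAN24.WardResidualRotatedVertexPeriodic (hasSum_totalCharge_of_periodic hasSum_slotMoment_of_periodic)

namespace Summit.QuantumFields.BalabanUV.Beta.GAN24.WardResidualRotatedVertexWeighted

variable {d : ℕ}

/-! ## §1 Leaf-06's Fubini with a bounded two-leg weight -/

/-- [folklore] **FUBINI FOR THE WEIGHTED SUPERPOSITION AGAINST A BOUNDED TWO-LEG WEIGHT** (`KernelLegCharges.hasSum_prod_wsum` with `ω` inserted): for weights `w` decaying
from a centre, kernels `Q y` bi-localised at `N•y`, and `|ω| ≤ B`:  `HasSum ((x,z) ↦ ω(x,z)·Σ'_y w y·Q y x z a b) (Σ'_y w y·Σ'_{(x,z)} ω(x,z)·Q y x z a b)`, and the outer family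
`y ↦ w y·(ω-charge of Q y)` is summable. -/
theorem hasSum_prod_wsum_weighted {N : ℕ} (hN : 1 ≤ N) {w : Site (d + 1) → ℝ} {Q : Site (d + 1) → MKer (d + 1) (Fib d)}
    {C δ Cq δq : ℝ} {u : Site (d + 1)} (hw : ∀ y, |w y| ≤ C * Real.exp (-δ * l1 ((N : ℤ) • y - u))) (hδ : 0 < δ)
    (hQ : ∀ y, BiLoc (Q y) ((N : ℤ) • y) ((N : ℤ) • y) Cq δq) (hδq : 0 < δq) (a b : Fib d)
    {ω : Site (d + 1) × Site (d + 1) → ℝ} {B : ℝ} (hω : ∀ xz, |ω xz| ≤ B) :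
    HasSum (fun xz : Site (d + 1) × Site (d + 1) => ω xz * ∑' y, w y * Q y xz.1 xz.2 a b)
        (∑' y, w y * ∑' xz : Site (d + 1) × Site (d + 1), ω xz * Q y xz.1 xz.2 a b) ∧
      Summable fun y => w y * ∑' xz : Site (d + 1) × Site (d + 1), ω xz * Q y xz.1 xz.2 a b := by
  have hs0 := summable_weight_mul_kernel hN hw hδ hQ hδq a b
  have hs : Summable (Function.uncurry fun (y : Site (d + 1)) (xz : Site (d + 1) × Site (d + 1)) => ω xz * (w y * Q y xz.1 xz.2 a b)) := by
    refine Summable.of_norm_bounded (hs0.abs.mul_left B) ?_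
    rintro ⟨y, xz⟩
    rw [Real.norm_eq_abs]
    show |ω xz * (w y * Q y xz.1 xz.2 a b)| ≤ B * |w y * Q y xz.1 xz.2 a b|
    rw [abs_mul]
    exact mul_le_mul_of_nonneg_right (hω xz) (abs_nonneg _)
  have hsw : Summable fun s : (Site (d + 1) × Site (d + 1)) × Site (d + 1) => ω s.1 * (w s.2 * Q s.2 s.1.1 s.1.2 a b) := hs.prod_symm
  have h1 : Summable fun xz : Site (d + 1) × Site (d + 1) => ∑' y, ω xz * (w y * Q y xz.1 xz.2 a b) := hsw.prod
  have h2 : ∑' (xz : Site (d + 1) × Site (d + 1)) (y : Site (d + 1)), ω xz * (w y * Q y xz.1 xz.2 a b)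
      = ∑' (y : Site (d + 1)) (xz : Site (d + 1) × Site (d + 1)), ω xz * (w y * Q y xz.1 xz.2 a b) := hs.tsum_comm
  have hfac : ∀ y, ∑' xz : Site (d + 1) × Site (d + 1), ω xz * (w y * Q y xz.1 xz.2 a b)
      = w y * ∑' xz : Site (d + 1) × Site (d + 1), ω xz * Q y xz.1 xz.2 a b := fun y => by
    rw [← tsum_mul_left]; exact tsum_congr fun xz => by ring
  have hval : ∑' (xz : Site (d + 1) × Site (d + 1)) (y : Site (d + 1)), ω xz * (w y * Q y xz.1 xz.2 a b)
      = ∑' y, w y * ∑' xz : Site (d + 1) × Site (d + 1), ω xz * Q y xz.1 xz.2 a b := by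
    rw [h2]; exact tsum_congr hfac
  refine ⟨?_, (hs.prod).congr fun y => ?_⟩
  · rw [← hval]
    refine h1.hasSum.congr_fun fun xz => ?_
    rw [tsum_mul_left]
  · show ∑' xz : Site (d + 1) × Site (d + 1), ω xz * (w y * Q y xz.1 xz.2 a b) = _
    exact hfac y

/-! ## §2 The ω-charge of a `dM`-read is the superposition of the ω-charges of its tables -/

section Reads

variable {N : ℕ}

/-- [folklore] **THE ω-CHARGE OF A CHAIN-RULE VERTEX, VALUE FORM + SLOT SUMMABILITY** (INTENT 1's `hasSum_prod_vertexOfK` with a bounded weight). -/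
theorem hasSum_weighted_vertexOfK {K' : MKer (d + 1) (Fib d)} {C' m : ℝ} {c₀ : Site (d + 1)} (μ : Fin (d + 1)) (y : Site (d + 1))
    (hw : ∀ (κ : Fin (d + 1)) (t : Site (d + 1)), |colH K' N μ y κ t| ≤ C' * Real.exp (-m * l1 (t - c₀))) (hm : 0 < m)
    {S : Fin (d + 1) → Site (d + 1) → MKer (d + 1) (Fib d)} {Cs δ : ℝ} (hS : LocStencil S Cs δ) (hδ : 0 < δ) (a b : Fib d)
    {ω : Site (d + 1) × Site (d + 1) → ℝ} {B : ℝ} (hω : ∀ xz, |ω xz| ≤ B) :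
    HasSum (fun xz : Site (d + 1) × Site (d + 1) => ω xz * vertexOfK K' N S μ y xz.1 xz.2 a b)
        (∑ κ : Fin (d + 1), ∑' t : Site (d + 1), colH K' N μ y κ t * ∑' xz : Site (d + 1) × Site (d + 1), ω xz * S κ t xz.1 xz.2 a b) ∧
      ∀ κ : Fin (d + 1), Summable fun t : Site (d + 1) => colH K' N μ y κ t * ∑' xz : Site (d + 1) × Site (d + 1), ω xz * S κ t xz.1 xz.2 a b := by
  have h1 : ∀ t : Site (d + 1), ((1 : ℕ) : ℤ) • t = t := fun t => by simp
  have key : ∀ κ : Fin (d + 1),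
      HasSum (fun xz : Site (d + 1) × Site (d + 1) => ω xz * ∑' t : Site (d + 1), colH K' N μ y κ t * S κ t xz.1 xz.2 a b)
          (∑' t : Site (d + 1), colH K' N μ y κ t * ∑' xz : Site (d + 1) × Site (d + 1), ω xz * S κ t xz.1 xz.2 a b) ∧
        Summable fun t : Site (d + 1) => colH K' N μ y κ t * ∑' xz : Site (d + 1) × Site (d + 1), ω xz * S κ t xz.1 xz.2 a b := by
    intro κ
    have hw' : ∀ t : Site (d + 1), |colH K' N μ y κ t| ≤ C' * Real.exp (-m * l1 (((1 : ℕ) : ℤ) • t - c₀)) := fun t => by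
      rw [h1]; exact hw κ t
    have hQ : ∀ t : Site (d + 1), BiLoc (S κ t) (((1 : ℕ) : ℤ) • t) (((1 : ℕ) : ℤ) • t) Cs δ := fun t => by rw [h1]; exact hS κ t
    exact hasSum_prod_wsum_weighted (N := 1) le_rfl hw' hm hQ hδ a b hω
  refine ⟨?_, fun κ => (key κ).2⟩
  have h := hasSum_sum (s := (Finset.univ : Finset (Fin (d + 1)))) fun κ _ => (key κ).1
  refine h.congr_fun fun xz => ?_
  simp only [vertexOfK, wsum, Finset.mul_sum]

/-- [folklore] **THE ω-CHARGE OF A MULTIPLIER VERTEX, VALUE FORM + SLOT SUMMABILITY**. -/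
theorem hasSum_weighted_vertexOfM [NeZero N] {K' : MKer (d + 1) (Fib d)} {C' m : ℝ} {c₀ : Site (d + 1)} (μ : Fin (d + 1)) (y : Site (d + 1))
    (hw : ∀ (ρ : Fin (d + 1)) (w : Site (d + 1)), |colM K' N μ y ρ w| ≤ C' * Real.exp (-m * l1 ((N : ℤ) • w - c₀))) (hm : 0 < m)
    {M : Fin (d + 1) → Site (d + 1) → MKer (d + 1) (Fib d)} {CM δ : ℝ} (hM : VertexFamily M N CM δ) (hδ : 0 < δ) (a b : Fib d)
    {ω : Site (d + 1) × Site (d + 1) → ℝ} {B : ℝ} (hω : ∀ xz, |ω xz| ≤ B) :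
    HasSum (fun xz : Site (d + 1) × Site (d + 1) => ω xz * vertexOfM K' N M μ y xz.1 xz.2 a b)
        (∑ ρ : Fin (d + 1), ∑' w : Site (d + 1), colM K' N μ y ρ w * ∑' xz : Site (d + 1) × Site (d + 1), ω xz * M ρ w xz.1 xz.2 a b) ∧
      ∀ ρ : Fin (d + 1), Summable fun w : Site (d + 1) => colM K' N μ y ρ w * ∑' xz : Site (d + 1) × Site (d + 1), ω xz * M ρ w xz.1 xz.2 a b := by
  have hN : 1 ≤ N := Nat.one_le_iff_ne_zero.2 (NeZero.ne N)
  have key : ∀ ρ : Fin (d + 1),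
      HasSum (fun xz : Site (d + 1) × Site (d + 1) => ω xz * ∑' w : Site (d + 1), colM K' N μ y ρ w * M ρ w xz.1 xz.2 a b)
          (∑' w : Site (d + 1), colM K' N μ y ρ w * ∑' xz : Site (d + 1) × Site (d + 1), ω xz * M ρ w xz.1 xz.2 a b) ∧
        Summable fun w : Site (d + 1) => colM K' N μ y ρ w * ∑' xz : Site (d + 1) × Site (d + 1), ω xz * M ρ w xz.1 xz.2 a b :=
    fun ρ => hasSum_prod_wsum_weighted hN (hw ρ) hm (hM ρ) hδ a b hω
  refine ⟨?_, fun ρ => (key ρ).2⟩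
  have h := hasSum_sum (s := (Finset.univ : Finset (Fin (d + 1)))) fun ρ _ => (key ρ).1
  refine h.congr_fun fun xz => ?_
  simp only [vertexOfM, cwsum_apply, Finset.mul_sum]

/-- [folklore] **THE ω-CHARGE OF an2's `dM`, VALUE FORM**. -/
theorem hasSum_weighted_dM [NeZero N] {K' : MKer (d + 1) (Fib d)} {C' m : ℝ} {c₀ c₁ : Site (d + 1)} (μ : Fin (d + 1)) (y : Site (d + 1))
    (hw : ∀ (κ : Fin (d + 1)) (t : Site (d + 1)), |colH K' N μ y κ t| ≤ C' * Real.exp (-m * l1 (t - c₀)))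
    (hw' : ∀ (ρ : Fin (d + 1)) (w : Site (d + 1)), |colM K' N μ y ρ w| ≤ C' * Real.exp (-m * l1 ((N : ℤ) • w - c₁))) (hm : 0 < m)
    {S : Fin (d + 1) → Site (d + 1) → MKer (d + 1) (Fib d)} {Cs δ : ℝ} (hS : LocStencil S Cs δ) (hδ : 0 < δ)
    {M : Fin (d + 1) → Site (d + 1) → MKer (d + 1) (Fib d)} {CM δM : ℝ} (hM : VertexFamily M N CM δM) (hδM : 0 < δM) (a b : Fib d)
    {ω : Site (d + 1) × Site (d + 1) → ℝ} {B : ℝ} (hω : ∀ xz, |ω xz| ≤ B) :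
    HasSum (fun xz : Site (d + 1) × Site (d + 1) => ω xz * dM K' N S M μ y xz.1 xz.2 a b)
      ((∑ κ : Fin (d + 1), ∑' t : Site (d + 1), colH K' N μ y κ t * ∑' xz : Site (d + 1) × Site (d + 1), ω xz * S κ t xz.1 xz.2 a b)
        + ∑ ρ : Fin (d + 1), ∑' w : Site (d + 1), colM K' N μ y ρ w * ∑' xz : Site (d + 1) × Site (d + 1), ω xz * M ρ w xz.1 xz.2 a b) := by
  have h := (hasSum_weighted_vertexOfK μ y hw hm hS hδ a b hω).1.add (hasSum_weighted_vertexOfM μ y hw' hm hM hδM a b hω).1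
  exact h.congr_fun fun xz => by rw [dM_apply, mul_add]

end Reads

/-! ## §3 The ω-charge of (α) at the comb is `V_Z` with the tables' ω-charges -/

section Comb

variable {Lc : ℕ} [NeZero Lc]

/-- NOT IN PRINT; OUR BOOKKEEPING.  **THE ω-CHARGE OF (α) PER SLOT, FOR ANY BOUNDED TWO-LEG WEIGHT**: for `G_{j+1} = coDressKBmAt ρ Lc (KInvStep Lc (j+1))`,
`S = SpureRecAt … (j+1)`, `M = M1At … (j+1)`, the block generator `X_y` of an in-block root, every slot `(ν,y′)`, channel `(a,b)` and `|ω| ≤ B`: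
`Σ'_{(x,z)} ω(x,z)·(½ • dM (conjV G_{j+1} X_y) Lc S M ν y′) x z a b = ½·[Σ_κ Σ'_u colH G_{j+1} ν y′ κ u·(½𝟙[y′=y] − ½𝟙[blk u = y])·Z_S(κ,u) + Σ_ρ′ Σ'_w colM G_{j+1} ν y′ ρ′ w·(½𝟙[y′=y] − ½𝟙[w=y])·Z_M(ρ′,w)]`
with `Z_S(κ,u) = Σ'_{(x,z)} ω·S κ u`, `Z_M(ρ′,w) = Σ'_{(x,z)} ω·M ρ′ w` — the `V_Z` of `WardResidualRotatedVertexPeriodic`.  (INTENT 1's plain pair charge is `ω ≡ 1`.) -/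
theorem hasSum_weighted_rotatedVertex_comb (hLc : 1 ≤ Lc) {r : Fin (d + 1) → ℕ} (hr : r ∈ box (d + 1) Lc) (cE cVH cΛ : ℝ) (j : ℕ)
    (y : Fin (d + 1) → ℤ) (ν : Fin (d + 1)) (y' : Fin (d + 1) → ℤ) (a b : Fib d) {ω : Site (d + 1) × Site (d + 1) → ℝ} {B : ℝ} (hω : ∀ xz, |ω xz| ≤ B) :
    HasSum (fun xz : Site (d + 1) × Site (d + 1) => ω xz *
        ((1 / 2 : ℝ) • dM (conjV (coDressKBmAt (toSite r) Lc (KInvStep (d := d) Lc (j + 1)))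
            (diagK (((1 : ℝ) / 2) • ∑ v ∈ box (d + 1) Lc, legInd (toSite r) ((Lc : ℤ) • y + toSite v)))) Lc
          (SpureRecAt d Lc (toSite r) cE cVH cΛ (j + 1)) (M1At d Lc (toSite r) cΛ (j + 1)) ν y') xz.1 xz.2 a b)
      ((1 / 2 : ℝ) *
        ((∑ κ : Fin (d + 1), ∑' u : Site (d + 1),
            colH (coDressKBmAt (toSite r) Lc (KInvStep (d := d) Lc (j + 1))) Lc ν y' κ u
              * ((if y' = y then (1 / 2 : ℝ) else 0) - (if blk Lc u = y then (1 / 2 : ℝ) else 0))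
              * ∑' xz : Site (d + 1) × Site (d + 1), ω xz * SpureRecAt d Lc (toSite r) cE cVH cΛ (j + 1) κ u xz.1 xz.2 a b)
          + ∑ ρ' : Fin (d + 1), ∑' w : Site (d + 1),
            colM (coDressKBmAt (toSite r) Lc (KInvStep (d := d) Lc (j + 1))) Lc ν y' ρ' w
              * ((if y' = y then (1 / 2 : ℝ) else 0) - (if w = y then (1 / 2 : ℝ) else 0))
              * ∑' xz : Site (d + 1) × Site (d + 1), ω xz * M1At d Lc (toSite r) cΛ (j + 1) ρ' w xz.1 xz.2 a b)) := by
  obtain ⟨δG, CG, hδG, hCG, hG⟩ := decays_coDressKBmAt_KInvStep (d := d) hr (j + 1)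
  have hg : ∀ p c, |(((1 : ℝ) / 2) • ∑ v ∈ box (d + 1) Lc, legInd (toSite r) ((Lc : ℤ) • y + toSite v)) p c| ≤
      |((1 : ℝ) / 2)| * (box (d + 1) Lc).card := fun p c => abs_blockGen_le Lc (toSite r) _ y p c
  have hK := decays_conjV_diagK hG hg
  obtain ⟨Cs, δs, hδs, hS⟩ := locStencil_SpureRecAt (d := d) (Lc := Lc) hLc hr cE cVH cΛ (j + 1)
  have hM := vertexFamily_M1At (d := d) hLc hr cΛ (j + 1) (zero_le_one)
  have h := (hasSum_weighted_dM (c₀ := (Lc : ℤ) • y') (c₁ := (Lc : ℤ) • y') ν y' (fun κ t => abs_colH_le (N := Lc) hK ν y' κ t)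
    (fun ρ w => abs_colM_le (N := Lc) hK ν y' ρ w) hδG hS hδs hM one_pos a b hω).mul_left (1 / 2 : ℝ)
  simp only [colH_conjV_diagK, colM_conjV_diagK, blockGen_inl hLc, blockGen_zsmul_inr hr] at h
  refine h.congr_fun fun xz => ?_
  simp only [Pi.smul_apply, smul_eq_mul]
  ring

end Comb

/-! ## §4 `Lc`-periodic weights: the hypotheses of `WardResidualRotatedVertexPeriodic` discharged -/

section Periodic

variable {Lc : ℕ} [NeZero Lc]

omit [NeZero Lc] in
/-- [folklore] A weight invariant under a simultaneous shift does not see that shift inside the kernel: `Σ' ω·(shiftK v K) = Σ' ω·K`. -/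
theorem tsum_weighted_shiftK_of_periodic {ω : Site (d + 1) × Site (d + 1) → ℝ} (v : Site (d + 1))
    (hω : ∀ xz : Site (d + 1) × Site (d + 1), ω (xz.1 + v, xz.2 + v) = ω xz) (K : MKer (d + 1) (Fib d)) (a b : Fib d) :
    ∑' xz : Site (d + 1) × Site (d + 1), ω xz * shiftK v K xz.1 xz.2 a b = ∑' xz : Site (d + 1) × Site (d + 1), ω xz * K xz.1 xz.2 a b := by
  rw [← (Equiv.prodCongr (Equiv.addRight v) (Equiv.addRight v)).tsum_eq (fun xz : Site (d + 1) × Site (d + 1) => ω xz * K xz.1 xz.2 a b)]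
  refine tsum_congr fun xz => ?_
  simp only [Equiv.prodCongr_apply, Equiv.coe_addRight, Prod.map, shiftK]
  rw [hω xz]

/-- [folklore] **THE ω-CHARGE OF THE COMB S-SLOT LETTER IS BLOCK-PERIODIC** for an `Lc`-periodic weight (`SpureRecAt_translate`):
`Z_S(κ, Lc•t + v) = Z_S(κ, v)`. -/
theorem weightedCharge_SpureRecAt_block (hLc : 1 ≤ Lc) (ρ : Fin (d + 1) → ℤ) (cE cVH cΛ : ℝ) (j : ℕ) (a b : Fib d)
    {ω : Site (d + 1) × Site (d + 1) → ℝ} (hωp : ∀ (s : Site (d + 1)) (xz : Site (d + 1) × Site (d + 1)), ω (xz.1 + (Lc : ℤ) • s, xz.2 + (Lc : ℤ) • s) = ω xz)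
    (κ : Fin (d + 1)) (t : Site (d + 1)) (v : Fin (d + 1) → ℕ) :
    ∑' xz : Site (d + 1) × Site (d + 1), ω xz * SpureRecAt d Lc ρ cE cVH cΛ j κ ((Lc : ℤ) • t + toSite v) xz.1 xz.2 a b =
      ∑' xz : Site (d + 1) × Site (d + 1), ω xz * SpureRecAt d Lc ρ cE cVH cΛ j κ (toSite v) xz.1 xz.2 a b := by
  rw [add_comm ((Lc : ℤ) • t) (toSite v), SpureRecAt_translate ρ hLc cE cVH cΛ j κ (toSite v) t]
  refine tsum_weighted_shiftK_of_periodic _ (fun xz => ?_) _ a b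
  have h := hωp (-t) xz
  rwa [smul_neg] at h

omit [NeZero Lc] in
/-- [folklore] **THE ω-CHARGE OF THE MIXED LETTER IS SLOT-FREE** for an `Lc`-periodic weight (`M1At_translate`): `Z_M(ρ′, w) = Z_M(ρ′, w′)`. -/
theorem weightedCharge_M1At_const (ρ : Fin (d + 1) → ℤ) (cΛ : ℝ) (j : ℕ) (a b : Fib d)
    {ω : Site (d + 1) × Site (d + 1) → ℝ} (hωp : ∀ (s : Site (d + 1)) (xz : Site (d + 1) × Site (d + 1)), ω (xz.1 + (Lc : ℤ) • s, xz.2 + (Lc : ℤ) • s) = ω xz)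
    (ρ' : Fin (d + 1)) (w w' : Site (d + 1)) :
    ∑' xz : Site (d + 1) × Site (d + 1), ω xz * M1At d Lc ρ cΛ j ρ' w xz.1 xz.2 a b =
      ∑' xz : Site (d + 1) × Site (d + 1), ω xz * M1At d Lc ρ cΛ j ρ' w' xz.1 xz.2 a b := by
  have e : w = w' + (w - w') := by abel
  rw [e, M1At_translate ρ cΛ j ρ' w' (w - w')]
  refine tsum_weighted_shiftK_of_periodic _ (fun xz => ?_) _ a b
  have h := hωp (-(w - w')) xz
  rwa [smul_neg] at h

end Periodic

/-! ## §5 (M0) = 0 and the slot-dipole for the ω-charges of (α), all hypotheses discharged -/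

section Moments

variable {Lc : ℕ} [NeZero Lc]

/-- NOT IN PRINT; OUR BOOKKEEPING.  **(M0) FOR THE ω-CHARGES OF (α)** — for EVERY bounded `Lc`-periodic two-leg weight `ω` (in particular the transported letter's exit-face
weights): the zeroth slot-moment of the ω-charge of (α) (the value of `hasSum_weighted_rotatedVertex_comb`) VANISHES, at every label `y`, slot direction `ν`, channel, level,
in-block root — `WardResidualRotatedVertexPeriodic.hasSum_totalCharge_of_periodic` with its three hypotheses supplied by §2 (slot summability) and §4 (periodicity). -/
theorem hasSum_totalCharge_weighted_comb (hLc : 1 ≤ Lc) {r : Fin (d + 1) → ℕ} (hr : r ∈ box (d + 1) Lc) (cE cVH cΛ : ℝ) (j : ℕ)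
    (y : Fin (d + 1) → ℤ) (ν : Fin (d + 1)) (a b : Fib d) {ω : Site (d + 1) × Site (d + 1) → ℝ} {B : ℝ} (hω : ∀ xz, |ω xz| ≤ B)
    (hωp : ∀ (s : Site (d + 1)) (xz : Site (d + 1) × Site (d + 1)), ω (xz.1 + (Lc : ℤ) • s, xz.2 + (Lc : ℤ) • s) = ω xz) :
    HasSum (fun y' : Site (d + 1) =>
        (1 / 2 : ℝ) *
          ((∑ κ : Fin (d + 1), ∑' u : Site (d + 1),
              colH (coDressKBmAt (toSite r) Lc (KInvStep (d := d) Lc (j + 1))) Lc ν y' κ u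
                * ((if y' = y then (1 / 2 : ℝ) else 0) - (if blk Lc u = y then (1 / 2 : ℝ) else 0))
                * ∑' xz : Site (d + 1) × Site (d + 1), ω xz * SpureRecAt d Lc (toSite r) cE cVH cΛ (j + 1) κ u xz.1 xz.2 a b)
            + ∑ ρ' : Fin (d + 1), ∑' w : Site (d + 1),
              colM (coDressKBmAt (toSite r) Lc (KInvStep (d := d) Lc (j + 1))) Lc ν y' ρ' w
                * ((if y' = y then (1 / 2 : ℝ) else 0) - (if w = y then (1 / 2 : ℝ) else 0))
                * ∑' xz : Site (d + 1) × Site (d + 1), ω xz * M1At d Lc (toSite r) cΛ (j + 1) ρ' w xz.1 xz.2 a b)) 0 := by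
  obtain ⟨δG, CG, hδG, hCG, hG⟩ := decays_coDressKBmAt_KInvStep (d := d) hr (j + 1)
  obtain ⟨Cs, δs, hδs, hS⟩ := locStencil_SpureRecAt (d := d) (Lc := Lc) hLc hr cE cVH cΛ (j + 1)
  exact hasSum_totalCharge_of_periodic hLc hr (j + 1) ν y
    (fun κ t v => weightedCharge_SpureRecAt_block hLc (toSite r) cE cVH cΛ (j + 1) a b hωp κ t v)
    (fun κ => (hasSum_weighted_vertexOfK (c₀ := (Lc : ℤ) • y) ν y (fun κ t => abs_colH_le (N := Lc) hG ν y κ t) hδG hS hδs a b hω).2 κ)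
    (fun ρ' w => weightedCharge_M1At_const (toSite r) cΛ (j + 1) a b hωp ρ' w y)

/-- NOT IN PRINT; OUR BOOKKEEPING.  **THE SLOT-DIPOLE OF THE ω-CHARGES OF (α), CLOSED AND LABEL-FREE** — for EVERY `Lc`-periodic two-leg weight `ω`:
`Σ_{y′} (y′−y)_λ·[ω-charge of (α) at slot (ν,y′)] = −¼·[Σ_κ Σ_{v∈box} (Σ'_t t_λ·colH G_{j+1} ν t κ v)·Z_S(κ,v) + Σ_ρ′ (Σ'_t t_λ·colM G_{j+1} ν t ρ′ 0)·Z_M(ρ′,0)]`,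
`Z_S ∕ Z_M` = the ω-charges of `S_{j+1} κ v` ∕ `M1_{j+1} ρ′ 0` — the (α) side of R12's (S) in any bounded block-periodic two-leg currency; the only `G`-dependent factors are the first
moments of ONE coarse column (idea-1 (4.9)). -/
theorem hasSum_slotMoment_weighted_comb (hLc : 1 ≤ Lc) {r : Fin (d + 1) → ℕ} (hr : r ∈ box (d + 1) Lc) (cE cVH cΛ : ℝ) (j : ℕ)
    (y : Fin (d + 1) → ℤ) (ν lam : Fin (d + 1)) (a b : Fib d) {ω : Site (d + 1) × Site (d + 1) → ℝ}
    (hωp : ∀ (s : Site (d + 1)) (xz : Site (d + 1) × Site (d + 1)), ω (xz.1 + (Lc : ℤ) • s, xz.2 + (Lc : ℤ) • s) = ω xz) :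
    HasSum (fun y' : Site (d + 1) =>
        (((y' lam : ℤ) : ℝ) - ((y lam : ℤ) : ℝ)) *
          ((1 / 2 : ℝ) *
            ((∑ κ : Fin (d + 1), ∑' u : Site (d + 1),
                colH (coDressKBmAt (toSite r) Lc (KInvStep (d := d) Lc (j + 1))) Lc ν y' κ u
                  * ((if y' = y then (1 / 2 : ℝ) else 0) - (if blk Lc u = y then (1 / 2 : ℝ) else 0))
                  * ∑' xz : Site (d + 1) × Site (d + 1), ω xz * SpureRecAt d Lc (toSite r) cE cVH cΛ (j + 1) κ u xz.1 xz.2 a b)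
              + ∑ ρ' : Fin (d + 1), ∑' w : Site (d + 1),
                colM (coDressKBmAt (toSite r) Lc (KInvStep (d := d) Lc (j + 1))) Lc ν y' ρ' w
                  * ((if y' = y then (1 / 2 : ℝ) else 0) - (if w = y then (1 / 2 : ℝ) else 0))
                  * ∑' xz : Site (d + 1) × Site (d + 1), ω xz * M1At d Lc (toSite r) cΛ (j + 1) ρ' w xz.1 xz.2 a b)))
      (-(1 / 4 : ℝ) *
        ((∑ κ : Fin (d + 1), ∑ v ∈ box (d + 1) Lc,
            (∑' t : Site (d + 1), ((t lam : ℤ) : ℝ) * colH (coDressKBmAt (toSite r) Lc (KInvStep (d := d) Lc (j + 1))) Lc ν t κ (toSite v))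
              * ∑' xz : Site (d + 1) × Site (d + 1), ω xz * SpureRecAt d Lc (toSite r) cE cVH cΛ (j + 1) κ (toSite v) xz.1 xz.2 a b)
          + ∑ ρ' : Fin (d + 1),
            (∑' t : Site (d + 1), ((t lam : ℤ) : ℝ) * colM (coDressKBmAt (toSite r) Lc (KInvStep (d := d) Lc (j + 1))) Lc ν t ρ' 0)
              * ∑' xz : Site (d + 1) × Site (d + 1), ω xz * M1At d Lc (toSite r) cΛ (j + 1) ρ' 0 xz.1 xz.2 a b)) :=
  hasSum_slotMoment_of_periodic hLc hr (j + 1) ν lam y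
    (fun κ t v => weightedCharge_SpureRecAt_block hLc (toSite r) cE cVH cΛ (j + 1) a b hωp κ t v)
    (fun ρ' w => weightedCharge_M1At_const (toSite r) cΛ (j + 1) a b hωp ρ' w 0)

end Moments

/-! ## §6 Additivity in the piece (the OWNER gan24-p1 g27's W4 ask: ONE sum over the σ-pieces without re-proving Fubini) -/

/-- [folklore] **THE ω-CHARGE IS ADDITIVE IN THE PIECE** (`HasSum` level): the (γ) twin, the (β) letter and the table-law piece plug into one sum with (α). -/
theorem hasSum_weightedCharge_add {ω : Site (d + 1) × Site (d + 1) → ℝ} {P₁ P₂ : MKer (d + 1) (Fib d)} {a b : Fib d} {v₁ v₂ : ℝ}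
    (h₁ : HasSum (fun xz : Site (d + 1) × Site (d + 1) => ω xz * P₁ xz.1 xz.2 a b) v₁)
    (h₂ : HasSum (fun xz : Site (d + 1) × Site (d + 1) => ω xz * P₂ xz.1 xz.2 a b) v₂) :
    HasSum (fun xz : Site (d + 1) × Site (d + 1) => ω xz * (P₁ + P₂) xz.1 xz.2 a b) (v₁ + v₂) := by
  simpa only [Pi.add_apply, mul_add] using h₁.add h₂

/-- [folklore] **THE ω-CHARGE IS HOMOGENEOUS IN THE PIECE** (`HasSum` level; the σ-pieces carry scalar prefactors `½`, `−(cE·wE)`, …). -/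
theorem hasSum_weightedCharge_smul {ω : Site (d + 1) × Site (d + 1) → ℝ} {P : MKer (d + 1) (Fib d)} {a b : Fib d} {v : ℝ} (c : ℝ)
    (h : HasSum (fun xz : Site (d + 1) × Site (d + 1) => ω xz * P xz.1 xz.2 a b) v) :
    HasSum (fun xz : Site (d + 1) × Site (d + 1) => ω xz * (c • P) xz.1 xz.2 a b) (c * v) := by
  have h' := h.mul_left c
  refine h'.congr_fun fun xz => ?_
  simp only [Pi.smul_apply, smul_eq_mul]
  ring

/-- [folklore] **SLOT FUNCTIONALS ARE ADDITIVE IN THE PIECE**: slot-moment `HasSum`s of two per-slot charge profiles add (the (M0) ∕ slot-dipole of `α + γ + β + τ` is the sum of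
the pieces' — the shape in which R12's (S) «dipole(α) + dipole(γ) (+ …) = 0» is consumed). -/
theorem hasSum_slotMoment_add {c q₁ q₂ : Site (d + 1) → ℝ} {v₁ v₂ : ℝ}
    (h₁ : HasSum (fun y' : Site (d + 1) => c y' * q₁ y') v₁) (h₂ : HasSum (fun y' : Site (d + 1) => c y' * q₂ y') v₂) :
    HasSum (fun y' : Site (d + 1) => c y' * (q₁ y' + q₂ y')) (v₁ + v₂) := by
  simpa only [mul_add] using h₁.add h₂

end Summit.QuantumFields.BalabanUV.Beta.GAN24.WardResidualRotatedVertexWeighted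

end
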